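import Summits.BirchSwinnertonDyer.BirchSwinnertonDyer.Theorems.GenusKolyvaginAtTwoEquivariantChebotarevAtTwoVisible
import Summits.BirchSwinnertonDyer.BirchSwinnertonDyer.Theorems.GenusKolyvaginAtTwoEquivariantKolyvaginExactAtTwoPropFourFourRat
import Summits.BirchSwinnertonDyer.BirchSwinnertonDyer.Theorems.GenusKolyvaginAtTwoEquivariantKolyvaginExactAtTwoEigenClassesFinite
import Summits.BirchSwinnertonDyer.BirchSwinnertonDyer.Theorems.GenusKolyvaginAtTwoEquivariantKolyvaginExactAtTwoTwinGrossPrimes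
import Summits.BirchSwinnertonDyer.BirchSwinnertonDyer.Theorems.GenusKolyvaginAtTwoEquivariantKolyvaginExactAtTwoPairBookkeeping
import HarnessLib

/-!
# Route `GenusKolyvaginAtTwo`, LINE 6 of crux `KolyvaginExactAtTwo` (22137), key child Q3′
# (stmt-BirchSwinnertonDyer-24882): the VISIBLE Čebotarev field of the `ℚ`-pair descent,
# `ℚ_ℓ`-currency (helper, PROVED; seat `bsd-line-gk2-p2` g11)

Displayed hypothesis (c) of the `ℚ`-pair instance of `KolyvaginDescent.VisiblePairHypothesesM`
(p632473; instance seat `bsd-line-gk2-p3`): the field `cebotarev` — Cor. 3.2 for PURE families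
`cs : Fin r → H¹(ℚ, E[q]) × H¹(ℚ, E^{(d_K)}[q])` (`q = 2^M`, each member in one factor) that are
independent after `rK₁ + rK₂` (restriction to `K(E[q])`), with the strict local conditions
`A₁ ℓ = torsionLocalKer_ℓ(E/ℚ)`, `A₂ ℓ = torsionLocalKer_ℓ(E^{(d_K)}/ℚ)` read over `ℚ_ℓ`.

* `cebotarev_visible_rat_of_not_isSquare` — on the habitat of LINE 6 (`E` non-CM globally minimal,
  `Δ(E) < 0`, `ρ_{E,2^∞}` onto, `K` imaginary quadratic with `d_K` odd and `K ≠ ℚ(√Δ_E)`),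
  UNCONDITIONALLY: for every bound `b` there is a Gross–Kolyvagin prime `ℓ > b` in the STRONG currency
  (`Frob_ℓ = Frob_∞` on `K(E[2^M])`, Zhang's predicate at level `N`, `M ≤ M(ℓ)`) such that, at the
  place `v ∋ ℓ` of `ℚ`, **`2^j·(cs i).1 ∈ torsionLocalKer_v(E) ∧ 2^j·(cs i).2 ∈ torsionLocalKer_v(E^{(d_K)})
  ⟺ Nv i ≤ j`** for all `i`, `j` — hence the field's `2^{Nv i}·cs i ∈ A₁ ℓ × A₂ ℓ`,
  `2^{Nv i − 1}·cs i ∉ A₁ ℓ × A₂ ℓ` (`cebotarev_visible_rat_field_of_not_isSquare`).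

Proof = transport of this lineage's `K_λ`-currency theorem
`GenusExact.equivariantChebotarevAtTwo_visible_of_not_isSquare` (p636164): the descended classes
`c'_i = res (cs i).1 + hPsiKT (res (cs i).2)` are `σ₀ = ±1` eigenclasses in `H¹(K, E[q])`
(`EigenClassesFinite`, seat gk2-p3), visibility of the pair gives `hvis`, non-vanishing and the order
bounds `Nv i ≤ M_i` for the `c'_i`; the local statement comes back to `ℚ_ℓ` through seat gk2-p3's
Kolyvagin-prime dictionary `zsmul_mem_torsionLocalKer_iff_resTorsion_of_notMem` (for `E` and for the
twin, which shares the Gross–Kolyvagin primes of `E`: `…TwinGrossPrimes`) and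
`zsmul_mem_torsionLocalKer_iff_hPsiKT_mem`. Helper (`--supports` 22137), closes nothing; THEOREMS ONLY,
0 sorry, standard axioms, no named fact. BSD is not proved by this.

References: [McCallumLMS1991] §3 Cor. 3.2 (p. 299), §5; [GrossLMS1991] §3 (3.1)–(3.3), §9;
[Kolyvagin1989Izv] §3 (the pair `(E, E^D)` over `ℚ`).
-/

set_option autoImplicit false
set_option linter.dupNamespace false -- tree convention: `Summit.BirchSwinnertonDyer.BirchSwinnertonDyer.Theorems` (summit = sub-problem)

noncomputable section

open scoped Classical

namespace Summit.BirchSwinnertonDyer.BirchSwinnertonDyer.Theorems.GenusExact.SelmerDescent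

open WeierstrassCurve NumberField IsDedekindDomain Field Finset
open Literature.NumberTheory.EllipticCurves Literature.NumberTheory.GaloisRepresentations
open Summit.BirchSwinnertonDyer.BirchSwinnertonDyer.Theorems.GenusExact.EigenClassesFinite
open Summit.BirchSwinnertonDyer.BirchSwinnertonDyer.Theorems.GenusExact.TwinGrossPrimes
open Summit.BirchSwinnertonDyer.BirchSwinnertonDyer.Theorems.GenusExact.VisiblePairAtTwo

/-! ## §1 Plumbing: an inert prime of a quadratic field has residue degree `2` -/

section Inert

variable {K : Type} [Field K] [NumberField K]

/-- **An inert prime of a quadratic field has residue degree `2`**: `[K : ℚ] = 2`, `(ℓ)` prime in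
`𝓞 K`, `w ∋ ℓ` a place of `K`, `v ∋ ℓ` the place of `ℚ`; then `w` is the ONLY place over `v` and
`f(w|v) = 2` (`ℓ` is unramified as `(ℓ)` is prime; `efg = 2` with `g = 1`).
[cite: GrossLMS1991, §3 ("𝔽_λ has ℓ² elements")] [cite: NeukirchANT1999, Ch. I §8 (8.2)] -/
theorem inertiaDeg_eq_two_of_span_isPrime (h2 : Module.finrank ℚ K = 2) {ℓ : ℕ}
    (hℓ : ℓ.Prime) (hprime : (Ideal.span {(ℓ : 𝓞 K)}).IsPrime) {v : HeightOneSpectrum (𝓞 ℚ)}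
    (hℓv : (ℓ : 𝓞 ℚ) ∈ v.asIdeal) {w : HeightOneSpectrum (𝓞 K)} (hℓw : (ℓ : 𝓞 K) ∈ w.asIdeal) :
    w.asIdeal.inertiaDeg (𝓞 ℚ) = 2 := by
  haveI : IsGalois ℚ K := isGalois_of_finrank_eq_two K h2
  have hw' : w.under (𝓞 ℚ) = v := HeightOneSpectrum.ext (under_eq_of_natCast_mem hℓ hℓv hℓw)
  have hunr : Algebra.IsUnramifiedIn (𝓞 K) v.asIdeal :=
    isUnramifiedIn_of_span_natCast_isPrime hℓ hprime hℓv
  have hp2 : (Module.finrank ℚ K).Prime := by rw [h2]; exact Nat.prime_two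
  -- uniqueness of the place above `ℓ`: every place containing `ℓ` is `(ℓ)`
  have hne : Ideal.span {(ℓ : 𝓞 K)} ≠ ⊥ := by
    rw [Ne, Ideal.span_singleton_eq_bot]
    exact_mod_cast hℓ.ne_zero
  have hmax := Ideal.IsPrime.isMaximal hprime hne
  have huniq : ∀ w' : HeightOneSpectrum (𝓞 K), (ℓ : 𝓞 K) ∈ w'.asIdeal → w' = w := fun w' hw'ℓ ↦ by
    have h1 : w'.asIdeal = Ideal.span {(ℓ : 𝓞 K)} :=
      (hmax.eq_of_le w'.isPrime.ne_top ((Ideal.span_singleton_le_iff_mem _).mpr hw'ℓ)).symm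
    have h2' : w.asIdeal = Ideal.span {(ℓ : 𝓞 K)} :=
      (hmax.eq_of_le w.isPrime.ne_top ((Ideal.span_singleton_le_iff_mem _).mpr hℓw)).symm
    exact HeightOneSpectrum.ext (h1.trans h2'.symm)
  rcases placesOver_dichotomy_of_prime (F := ℚ) (M := K) hp2 hunr with ⟨hN, -⟩ | ⟨-, hf⟩
  · exfalso
    have h1 : Nat.card {w' : HeightOneSpectrum (𝓞 K) // w'.under (𝓞 ℚ) = v} = 1 := by
      rw [Nat.card_eq_one_iff_exists]
      refine ⟨⟨w, hw'⟩, fun w' ↦ Subtype.ext (huniq w'.1 ?_)⟩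
      haveI : w'.1.asIdeal.LiesOver v.asIdeal := ⟨(congrArg HeightOneSpectrum.asIdeal w'.2).symm⟩
      exact natCast_mem_of_liesOver hℓv w'.1
    rw [h1, h2] at hN
    exact absurd hN (by decide)
  · rw [hf w hw', h2]

end Inert


/-! ## §2 The visible Čebotarev field over `ℚ` -/

section Main

variable {K : Type} [Field K] [NumberField K]

/-- **Cor. 3.2 at `p = 2`, VISIBLE form, for pure families of the `ℚ`-pair `(E, E^{(d_K)})`,
`ℚ_ℓ`-currency** — the `cebotarev` field of `KolyvaginDescent.VisiblePairHypothesesM` for the LINE-6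
instance. Data: `E = W/ℚ` globally minimal, non-CM, `Δ(E) < 0`, `ρ_{E,2^n}` onto for all `n`;
`K = ℚ(θ)` imaginary quadratic, `θ² = d_K` odd, `d_K·(−|Δ|)` not a square (`K ≠ ℚ(√Δ_E)`); a level
`N` divisible by the conductor; `q = 2^M`, `M ≥ 1`. For a family `cs i = (u_i, y_i) ∈ H¹(ℚ, E[q]) ×
H¹(ℚ, E^{(d_K)}[q])` that is PURE (`y_i = 0 ∨ u_i = 0`), non-zero with `2^{Nv i − 1} cs i ≠ 0`, and
VISIBLE (a `ℤ`-relation among the descended classes `res u_i + hPsiKT (res y_i) ∈ H¹(K, E[q])` holding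
after the pairing with `Γ_{K(E[q])}` is trivial termwise on the `cs i`), and every bound `b`: there is
`ℓ > b` with `Frob_ℓ = Frob_∞` on `K(E[q])`, `ℓ` a Zhang–Kolyvagin prime at `2` of level `N`,
`M ≤ M(ℓ)`, and at the place `v ∋ ℓ` of `ℚ`, for all `i, j`:
`2^j u_i ∈ torsionLocalKer_v(E) ∧ 2^j y_i ∈ torsionLocalKer_v(E^{(d_K)}) ⟺ Nv i ≤ j`.
[cite: McCallumLMS1991, §3 Cor. 3.2 (p. 299) and §5] [cite: Kolyvagin1989Izv, §3]
[cite: GrossLMS1991, §3 (3.1)–(3.3)] -/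
theorem cebotarev_visible_rat_of_not_isSquare
    (N : ℕ) [NeZero N] (W : WeierstrassCurve ℚ) [W.IsElliptic] [W.IsGloballyMinimal]
    (hN : W.conductorNorm ℤ ∣ N) (hcm : ¬ W.HasCM) (hΔ : W.Δ < 0) (K : Type) [Field K] [NumberField K]
    (hK : IsImaginaryQuadratic K) (hodd : Odd (NumberField.discr K))
    (hns : ¬ IsSquare ((NumberField.discr K : ℚ) * -|W.Δ|))
    (hρ : ∀ n : ℕ, W.HasSurjectiveModNGaloisRep (2 ^ n : ℕ))
    {θ : K} (hθ : θ ∉ Set.range (algebraMap ℚ K))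
    (hc : θ ^ 2 = algebraMap ℚ K ((NumberField.discr K : ℤ) : ℚ))
    [(W.quadraticTwist ((NumberField.discr K : ℤ) : ℚ)).IsElliptic]
    (M : ℕ) (hM : 1 ≤ M) {q : ℕ} (hq : q = 2 ^ M) (r : ℕ)
    (cs : Fin r → galH1Torsion W (q : ℤ) ×
      galH1Torsion (W.quadraticTwist ((NumberField.discr K : ℤ) : ℚ)) (q : ℤ))
    (Nv : Fin r → ℕ) (h0 : ∀ i, cs i ≠ 0)
    (hNv : ∀ i, Nv i ≠ 0 → ((2 : ℤ) ^ (Nv i - 1)) • cs i ≠ 0)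
    (hpure : ∀ i, (cs i).2 = 0 ∨ (cs i).1 = 0)
    (hvis : ∀ a : Fin r → ℤ, (∀ ρ ∈ torsionFixing (W.baseChange K) (q : ℤ),
      h1Eval (W.baseChange K) (q : ℤ) (∑ i, a i • (resTorsion W K (q : ℤ) (cs i).1 +
        hPsiKT W K hθ hc (q : ℤ)
          (resTorsion (W.quadraticTwist ((NumberField.discr K : ℤ) : ℚ)) K (q : ℤ) (cs i).2))) ρ = 0) →
      ∀ i, a i • cs i = 0)
    (b : ℕ) :
    ∃ ℓ : ℕ, b < ℓ ∧ FrobEqFrobInfty W K q ℓ ∧ Zhang2014.IsKolyvaginPrime N W K 2 ℓ ∧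
      M ≤ Zhang2014.kolyvaginIndex W 2 ℓ ∧
      ∀ i, ∀ v : HeightOneSpectrum (𝓞 ℚ), (ℓ : 𝓞 ℚ) ∈ v.asIdeal → ∀ j : ℕ,
        ((((2 : ℤ) ^ j) • (cs i).1 ∈ W.torsionLocalKer (v.adicCompletion ℚ) (q : ℤ) ∧
          ((2 : ℤ) ^ j) • (cs i).2 ∈
            (W.quadraticTwist ((NumberField.discr K : ℤ) : ℚ)).torsionLocalKer
              (v.adicCompletion ℚ) (q : ℤ)) ↔ Nv i ≤ j) := by
  classical
  subst hq
  haveI : Fact (Nat.Prime 2) := ⟨Nat.prime_two⟩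
  have h2K : Module.finrank ℚ K = 2 := hK.1
  have hd0 : ((NumberField.discr K : ℤ) : ℚ) ≠ 0 := by exact_mod_cast NumberField.discr_ne_zero K
  -- ### no `K`-rational `2^M`-torsion on the habitat
  have hL := forall_zsmul_two_pow_baseChange_eq_zero_of_hasSurjectiveModNGaloisRep_two W K h2K
    (by simpa using hρ 1) M
  -- ### the descended family `c'_i = res u_i + hPsiKT (res y_i)` and its signs
  set cs' : Fin r → galH1Torsion (W.baseChange K) ((2 ^ M : ℕ) : ℤ) := fun i ↦
    resTorsion W K ((2 ^ M : ℕ) : ℤ) (cs i).1 + hPsiKT W K hθ hc ((2 ^ M : ℕ) : ℤ)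
      (resTorsion (W.quadraticTwist ((NumberField.discr K : ℤ) : ℚ)) K ((2 ^ M : ℕ) : ℤ) (cs i).2)
    with hcs'
  set sgn : Fin r → ℤ := fun i ↦ if (cs i).2 = 0 then 1 else -1 with hsgn_def
  have hsgn : ∀ i, sgn i = 1 ∨ sgn i = -1 := fun i ↦ by
    simp only [hsgn_def]
    split_ifs
    · exact Or.inl rfl
    · exact Or.inr rfl
  -- linearity of the descent
  have hlin : ∀ (a : ℤ) (i : Fin r), a • cs' i =
      resTorsion W K ((2 ^ M : ℕ) : ℤ) (a • cs i).1 + hPsiKT W K hθ hc ((2 ^ M : ℕ) : ℤ)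
        (resTorsion (W.quadraticTwist ((NumberField.discr K : ℤ) : ℚ)) K ((2 ^ M : ℕ) : ℤ)
          (a • cs i).2) := by
    intro a i
    simp only [hcs', Prod.smul_fst, Prod.smul_snd, zsmul_add, map_zsmul]
  -- ### visibility: a multiple of `cs i` dying after descent dies
  have hvis1 : ∀ (a : ℤ) (i : Fin r), a • cs' i = 0 → a • cs i = 0 := by
    intro a i ha
    have key := hvis (Pi.single i a) (fun ρ hρ ↦ ?_) i
    · simpa using key
    · rw [Finset.sum_eq_single i (fun k _ hk ↦ by rw [Pi.single_eq_of_ne hk, zero_smul])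
        (fun h ↦ absurd (Finset.mem_univ i) h), Pi.single_eq_same]
      change h1Eval (W.baseChange K) ((2 ^ M : ℕ) : ℤ) (a • cs' i) ρ = 0
      rw [ha, h1Eval_zero _ _ hρ]
  have h0' : ∀ i, cs' i ≠ 0 := by
    intro i h
    apply h0 i
    have := hvis1 1 i (by rw [one_zsmul]; exact h)
    rwa [one_zsmul] at this
  -- ### the descended classes are `σ₀ = ±1` eigenclasses
  have hτs : ∀ i, conjAct W (sigmaQ K h2K hθ hc) ((2 ^ M : ℕ) : ℤ) (cs' i) = sgn i • cs' i := by
    intro i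
    rcases hpure i with h2 | h1
    · have hsg : sgn i = 1 := if_pos h2
      have hcs'i : cs' i = resTorsion W K ((2 ^ M : ℕ) : ℤ) (cs i).1 := by
        simp only [hcs', h2, map_zero, add_zero]
      rw [hsg, one_zsmul, hcs'i]
      exact (mem_range_resTorsion_iff_conjAct_eq W K h2K hθ hc _ hL _).mp ⟨_, rfl⟩
    · have hne2 : (cs i).2 ≠ 0 := fun h2 ↦ h0 i (Prod.ext h1 h2)
      have hsg : sgn i = -1 := if_neg hne2
      have hcs'i : cs' i = hPsiKT W K hθ hc ((2 ^ M : ℕ) : ℤ)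
          (resTorsion (W.quadraticTwist ((NumberField.discr K : ℤ) : ℚ)) K ((2 ^ M : ℕ) : ℤ)
            (cs i).2) := by
        simp only [hcs', h1, map_zero, zero_add]
      rw [hsg, neg_one_zsmul, hcs'i]
      exact (exists_hPsiKT_resTorsion_eq_iff_conjAct_eq_neg W K h2K hθ hc _ hL _).mp ⟨_, rfl⟩
  -- ### orders `2^{M_i}` of the `c'_i`, and `Nv i ≤ M_i` by visibility
  have hkill : ∀ z : galH1Torsion (W.baseChange K) ((2 ^ M : ℕ) : ℤ), ((2 ^ M : ℕ) : ℤ) • z = 0 :=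
    zsmul_galH1Torsion_eq_zero _ _
  have hord : ∀ i, ∃ e : ℕ, e ≤ M ∧ addOrderOf (cs' i) = 2 ^ e := by
    intro i
    have hdvd : addOrderOf (cs' i) ∣ 2 ^ M := by
      apply addOrderOf_dvd_of_nsmul_eq_zero
      rw [← natCast_zsmul]
      exact_mod_cast hkill (cs' i)
    exact (Nat.dvd_prime_pow Nat.prime_two).mp hdvd
  choose Mi hMiM hMi using hord
  have hNe : ∀ i, Nv i ≤ Mi i := by
    intro i
    by_contra hlt
    have hlt' : Mi i < Nv i := Nat.lt_of_not_le hlt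
    have hNv0 : Nv i ≠ 0 := by omega
    apply hNv i hNv0
    apply hvis1
    have h2 : ((2 : ℤ) ^ Mi i) • cs' i = 0 := by
      have h := addOrderOf_nsmul_eq_zero (cs' i)
      rw [hMi i, ← natCast_zsmul] at h
      exact_mod_cast h
    rw [show Nv i - 1 = (Nv i - 1 - Mi i) + Mi i by omega, pow_add, mul_smul, h2, zsmul_zero]
  -- ### `hvis` for the descended family
  have hvisK : ∀ a : Fin r → ℤ, (∀ ρ ∈ torsionFixing (W.baseChange K) ((2 ^ M : ℕ) : ℤ),
      h1Eval (W.baseChange K) ((2 ^ M : ℕ) : ℤ) (∑ i, a i • cs' i) ρ = 0) →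
      ∀ i, a i • cs' i = 0 := by
    intro a ha i
    have h := hvis a ha i
    rw [hlin, h]
    simp only [Prod.fst_zero, Prod.snd_zero, map_zero, add_zero]
  -- ### the `K_λ`-currency theorem
  have hσ : sigmaQ K h2K hθ hc ≠ 1 := sigmaQ_ne_one K h2K hθ hc
  have hinf := equivariantChebotarevAtTwo_visible_of_not_isSquare N W hcm hΔ K hK hns hρ
    (sigmaQ K h2K hθ hc) hσ M hM r cs' sgn hsgn h0' hτs hvisK Mi hMi Nv hNe
  obtain ⟨ℓ, ⟨hFrob, hKol, hidx, hloc⟩, hbℓ⟩ := hinf.exists_gt b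
  refine ⟨ℓ, hbℓ, hFrob, hKol, hidx, fun i v hℓv j ↦ ?_⟩
  -- ### bookkeeping at `ℓ`: good reduction for `E` and the twin, the inert place `w`, `f = 2`
  have hℓ : ℓ.Prime := hKol.1
  have hℓ2 : ℓ ≠ 2 := hKol.2.2.2.1
  have hℓN : ¬ ℓ ∣ W.conductorNorm ℤ := fun h ↦ hKol.2.1 (h.trans hN)
  have hℓd : ¬ ((ℓ : ℤ) ∣ NumberField.discr K) := hKol.2.2.1
  have hprime : (Ideal.span {(ℓ : 𝓞 K)}).IsPrime := hKol.2.2.2.2.1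
  haveI : Fact ℓ.Prime := ⟨hℓ⟩
  have hgoodℓ : W.HasGoodReductionAtPrime ℓ := hasGoodReductionAtPrime_of_not_dvd_conductorNorm W hℓN
  have hgood : W.HasGoodReductionAt v := hasGoodReductionAt_of_hasGoodReductionAtPrime W hgoodℓ hℓv
  have h1C : (1 : VariableChange ℚ) • W.quadraticTwist ((NumberField.discr K : ℤ) : ℚ) =
      W.quadraticTwist ((NumberField.discr K : ℤ) : ℚ) := one_smul _ _
  have hgoodℓ' : (W.quadraticTwist ((NumberField.discr K : ℤ) : ℚ)).HasGoodReductionAtPrime ℓ :=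
    hasGoodReductionAtPrime_of_smul_quadraticTwist_eq W h2K hodd _ h1C hℓd hgoodℓ
  have hgood' : (W.quadraticTwist ((NumberField.discr K : ℤ) : ℚ)).HasGoodReductionAt v :=
    hasGoodReductionAt_of_hasGoodReductionAtPrime _ hgoodℓ' hℓv
  have hΔ' : (W.quadraticTwist ((NumberField.discr K : ℤ) : ℚ)).Δ < 0 :=
    Δ_neg_of_smul_quadraticTwist_eq W hd0 _ h1C hΔ
  have hFrob' : FrobEqFrobInfty (W.quadraticTwist ((NumberField.discr K : ℤ) : ℚ)) K (2 ^ M) ℓ :=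
    frobEqFrobInfty_of_smul_quadraticTwist_eq W hK _ h1C hFrob
  obtain ⟨w, hℓw⟩ := exists_natCast_mem (K := K) hℓ
  have hf := inertiaDeg_eq_two_of_span_isPrime h2K hℓ hprime hℓv hℓw
  haveI : w.asIdeal.LiesOver v.asIdeal := liesOver_of_natCast_mem hℓ hℓv hℓw
  have hθ' : θ ∉ (algebraMap ℚ K).range := by rwa [RingHom.mem_range, ← Set.mem_range]
  have hcv : (((NumberField.discr K : ℤ) : ℤ) : 𝓞 ℚ) ∉ v.asIdeal := intCast_notMem_of_not_dvd hℓ hℓv hℓd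
  -- the local statement for `c'_i` at `w`
  have hlocw : ((2 : ℤ) ^ j) • cs' i ∈
      (W.baseChange K).torsionLocalKer (w.adicCompletion K) ((2 ^ M : ℕ) : ℤ) ↔ Nv i ≤ j := by
    have h := hloc i w hℓw j
    push_cast at h
    exact h
  -- ### back to `ℚ_ℓ`, by purity
  rcases hpure i with h2 | h1
  · have hcs'i : cs' i = resTorsion W K ((2 ^ M : ℕ) : ℤ) (cs i).1 := by
      simp only [hcs', h2, map_zero, add_zero]
    rw [h2, zsmul_zero]
    simp only [AddSubgroup.zero_mem, and_true]
    rw [zsmul_mem_torsionLocalKer_iff_resTorsion_of_notMem W hΔ hM rfl hℓ hℓ2 hℓv hgood h2K hθ' hc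
      hcv hFrob w hf (cs i).1 ((2 : ℤ) ^ j), ← hcs'i]
    exact hlocw
  · have hcs'i : cs' i = hPsiKT W K hθ hc ((2 ^ M : ℕ) : ℤ)
        (resTorsion (W.quadraticTwist ((NumberField.discr K : ℤ) : ℚ)) K ((2 ^ M : ℕ) : ℤ)
          (cs i).2) := by
      simp only [hcs', h1, map_zero, zero_add]
    rw [h1, zsmul_zero]
    simp only [AddSubgroup.zero_mem, true_and]
    rw [zsmul_mem_torsionLocalKer_iff_resTorsion_of_notMem (W.quadraticTwist _) hΔ' hM rfl hℓ hℓ2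
      hℓv hgood' h2K hθ' hc hcv hFrob' w hf (cs i).2 ((2 : ℤ) ^ j),
      zsmul_mem_torsionLocalKer_iff_hPsiKT_mem W K hθ hc _ (w.adicCompletion K) _ ((2 : ℤ) ^ j),
      ← hcs'i]
    exact hlocw

/-- **The `cebotarev` field of the `ℚ`-pair instance, literally** (pair-field shape of
`cebotarev_visible_rat_of_not_isSquare`): for every bound `b` a Gross–Kolyvagin prime `ℓ > b`
(strong currency) with, at the place `v ∋ ℓ` of `ℚ` and `A₁ = torsionLocalKer_v(E)`,
`A₂ = torsionLocalKer_v(E^{(d_K)})`: **`2^{Nv i}·cs i ∈ A₁ × A₂` and, if `Nv i ≠ 0`,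
`2^{Nv i − 1}·cs i ∉ A₁ × A₂`** ("`ord c_{i,λ} = p^{N_i}`").
[cite: McCallumLMS1991, §3 Cor. 3.2 (p. 299)] [cite: Kolyvagin1989Izv, §3] -/
theorem cebotarev_visible_rat_field_of_not_isSquare
    (N : ℕ) [NeZero N] (W : WeierstrassCurve ℚ) [W.IsElliptic] [W.IsGloballyMinimal]
    (hN : W.conductorNorm ℤ ∣ N) (hcm : ¬ W.HasCM) (hΔ : W.Δ < 0) (K : Type) [Field K] [NumberField K]
    (hK : IsImaginaryQuadratic K) (hodd : Odd (NumberField.discr K))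
    (hns : ¬ IsSquare ((NumberField.discr K : ℚ) * -|W.Δ|))
    (hρ : ∀ n : ℕ, W.HasSurjectiveModNGaloisRep (2 ^ n : ℕ))
    {θ : K} (hθ : θ ∉ Set.range (algebraMap ℚ K))
    (hc : θ ^ 2 = algebraMap ℚ K ((NumberField.discr K : ℤ) : ℚ))
    [(W.quadraticTwist ((NumberField.discr K : ℤ) : ℚ)).IsElliptic]
    (M : ℕ) (hM : 1 ≤ M) {q : ℕ} (hq : q = 2 ^ M) (r : ℕ)
    (cs : Fin r → galH1Torsion W (q : ℤ) ×
      galH1Torsion (W.quadraticTwist ((NumberField.discr K : ℤ) : ℚ)) (q : ℤ))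
    (Nv : Fin r → ℕ) (h0 : ∀ i, cs i ≠ 0)
    (hNv : ∀ i, Nv i ≠ 0 → ((2 : ℤ) ^ (Nv i - 1)) • cs i ≠ 0)
    (hpure : ∀ i, (cs i).2 = 0 ∨ (cs i).1 = 0)
    (hvis : ∀ a : Fin r → ℤ, (∀ ρ ∈ torsionFixing (W.baseChange K) (q : ℤ),
      h1Eval (W.baseChange K) (q : ℤ) (∑ i, a i • (resTorsion W K (q : ℤ) (cs i).1 +
        hPsiKT W K hθ hc (q : ℤ)
          (resTorsion (W.quadraticTwist ((NumberField.discr K : ℤ) : ℚ)) K (q : ℤ) (cs i).2))) ρ = 0) →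
      ∀ i, a i • cs i = 0)
    (b : ℕ) :
    ∃ ℓ : ℕ, b < ℓ ∧ (FrobEqFrobInfty W K q ℓ ∧ Zhang2014.IsKolyvaginPrime N W K 2 ℓ ∧
      M ≤ Zhang2014.kolyvaginIndex W 2 ℓ) ∧
      ∀ v : HeightOneSpectrum (𝓞 ℚ), (ℓ : 𝓞 ℚ) ∈ v.asIdeal → ∀ i,
        ((2 : ℤ) ^ Nv i) • cs i ∈ (W.torsionLocalKer (v.adicCompletion ℚ) (q : ℤ)).prod
            ((W.quadraticTwist ((NumberField.discr K : ℤ) : ℚ)).torsionLocalKer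
              (v.adicCompletion ℚ) (q : ℤ)) ∧
          (Nv i ≠ 0 → ((2 : ℤ) ^ (Nv i - 1)) • cs i ∉
            (W.torsionLocalKer (v.adicCompletion ℚ) (q : ℤ)).prod
              ((W.quadraticTwist ((NumberField.discr K : ℤ) : ℚ)).torsionLocalKer
                (v.adicCompletion ℚ) (q : ℤ))) := by
  obtain ⟨ℓ, hbℓ, hFrob, hKol, hidx, hloc⟩ := cebotarev_visible_rat_of_not_isSquare N W hN hcm hΔ K
    hK hodd hns hρ hθ hc M hM hq r cs Nv h0 hNv hpure hvis b
  refine ⟨ℓ, hbℓ, ⟨hFrob, hKol, hidx⟩, fun v hℓv i ↦ ⟨?_, fun hNv0 hmem ↦ ?_⟩⟩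
  · rw [AddSubgroup.mem_prod, Prod.smul_fst, Prod.smul_snd]
    exact (hloc i v hℓv (Nv i)).mpr le_rfl
  · rw [AddSubgroup.mem_prod, Prod.smul_fst, Prod.smul_snd] at hmem
    have := (hloc i v hℓv (Nv i - 1)).mp hmem
    omega

end Main

end Summit.BirchSwinnertonDyer.BirchSwinnertonDyer.Theorems.GenusExact.SelmerDescent

end
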